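import Summits.QuantumFields.BalabanUV.Beta.D1BFx.NeedleNdlDipWord
import Summits.QuantumFields.BalabanUV.Beta.D1BFx.NeedleDipDipLetters
import Summits.QuantumFields.BalabanUV.Beta.D1BFx.GluonLocalNdlLetters

/-!
# `BalabanUV.Beta.D1BFx.NeedleNdlDipEnvelope` — road «BF-x» for binder row D1, slot (K), END row `hGrp gN`, «GN-33 ∕ NK+KN» PART 5: THE SIXTEEN
# LETTERS INSTANTIATED AT THE TREE's OBJECTS AND THE n-POWERS CANCELLED — `|biBubbleTable Ga Ga (ndlPiece cQ) dipPiece κ κ′ u v|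
# ≤ Σ_{s∈B(blk u)} |qJet_u s|·(A₁·n⁻⁴·e₄(s−v)∕nrm(s−v) + A₀·n⁻⁵·e₄(s−v))` with `A₁, A₀, δ` depending on `a` and `cQ₀` only,
# modulo [B5, Prop. 1.2] ∧ [B5, (1.126)–(1.127)] BY NAME

HONEST DEPENDENCY (cell records, verbatim): «continuum YM on T⁴ ⇐ BetaPertH ∧ nine spine estimates (0/9 proved); BetaPertH ⇐ (D1) ∧ (D4) ∧
CAP+tail; G-an2-4 gates asym, D1 and NE2/3/4.»  HONEST FRAMING (cell contract, verbatim): «discharging `BetaPertH` makes Bałaban's UV stability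
UNCONDITIONAL — a real constructive-QFT result; it is NOT the continuum limit and NOT the Clay problem.»  THIS MODULE DISCHARGES NOTHING of the
wall: [folklore] bookkeeping; the two NAMED printed statements `B5.Prop12Printed (fam nOf hn1 MOf a ha)` ([B5, Prop. 1.2]) and
`B5.Kernel126_127Printed (kfam nOf MOf)` ([B5, (1.126)–(1.127)]) enter ONLY through the letters — leaf-04-g9's `NeedleDipDipLetters.exists_legLetters`,
my `NeedleNdlProjLetters.exists_applyK_grad_row_le`, `GluonLocalNdlLetters.exists_applyK_grad_row_diff_le` ∕ `exists_applyK_gradC_diff_le`, the owner's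
`NeedleColumnLetters.exists_applyK_gradC_le`, `GluonLegTails.spr_Ga_of_prop12` — as HYPOTHESES BY NAME; the dip functions' letters
`NeedleDipDipLetters.exists_functionLetters` are unconditional; the pairings are `NeedleNdlDipRowLetters` ∕ `NeedleNdlDipColLetters` ∕ `NeedleNdlDipByParts`,
the algebra `NeedleNdlDipWord.abs_ndlDip_word_le`.  No `def`, no `def … : Prop`, nothing cited, 0 sorry.  Root-level binders hW ∕ hR-sockets ∕ hSX-socket ∕
D1Tel ∕ D1Rep — 0 discharged; (K) NOT closed; NOT D1, NOT `BetaPertH`, NOT continuum, NOT Clay.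

ABSOLUTE RULE (cell charter, verbatim): «No internally-minted statement may enter as a cited fact. Every hypothesis is either kernel-proved in
this package or a verbatim quotation of a PUBLISHED theorem with page reference. The manuscript(s) under audit are NOT citable for their own
disputed steps — they are the thing under adjudication; programme-internal (2001/route/tribunal) claims are never citable.»

WHY (owner d1-p2 gen 11 RULING ρ-g11-2 ∕ ρ-g11-3; my statement line l.31599).  COUNT.  One common rate `δ = min(ε₁, ε₂, dR∕2, δ_C, ε₁′)` below every
native rate; the dip letters at scale `n`: `∇p_v ~ cF∕n⁵`, `∇δp_v ~ cF∕n⁶` (flat), `∇ρ_v ~ kR∕n²·e∕nrm³`, `δρ_v ~ kR∕n²·e∕nrm³`; needle side `kP∕n²` (row),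
`kΦ∕n²`, `kΦ′∕n²`; column `C₀∕n`, `Ga∇C ~ n`, `d1(Ga∇C) ~ n⁰`.  The sixteen constants: `K11 ~ n⁻⁴`, `K12 ~ n⁻³`, `K13 ~ n⁻⁴`, `K14 ~ n⁻⁵` (= `K4j`);
`K21 ~ n⁻¹`, `K22 ~ n⁰`, `K23 ~ n⁰`, `K24 ~ n⁻¹` (= `K3j`) ⇒ `A₁ = K11K23 + K33K41 + e^{δ∕4}(K12K24 + K34K42) = Ā₁·n⁻⁴`,
`A₀ = K31K43 + K32K44 + K13K21 + K14K22 = Ā₀·n⁻⁵` EXACTLY (`field_simp`).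
* §1 [folklore] **`exists_word_envelope`**.
NOT HERE (honest): the census and the cells (`NeedleNdlDipRow`, `NeedleDipNdlRow`).
Unit `b2b-balaban-beta-d1-formalise-leaf-01` (gen 15), D1 formalisation swarm LEAF PROVER 01; `LEAVES-BFx.md` row (N) «GN-33∕NK+KN» part 5.
-/

noncomputable section

namespace Summit.QuantumFields.BalabanUV.Beta.D1BFx.NeedleNdlDipEnvelope

open Finset
open scoped BigOperators
open Literature.MathematicalPhysics.QuantumFieldTheory.Balaban1983to89
open Literature.MathematicalPhysics.QuantumFieldTheory.Balaban1983to89.Beta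
open B6QGQLower276 (X e blk B mem_B)
open ExpKernelCalculus (Site MKer)
open DyadicShell (Pt)
open AffineAveraging (unitVec)
open Beta.PoissonInterior (nrm nrm_pos nrm_neg)
open VectorTailsLoc (fam kfam)
open Summit.QuantumFields.BalabanUV.Beta.TameKernelCalculus (Spr)
open Summit.QuantumFields.BalabanUV.Beta.D1BFx.RProjector (Pgt kerP deltaPP deltaP deltaPP_pos deltaP_pos)
open Summit.QuantumFields.BalabanUV.Beta.D1BFx.ProjectorSupNorm (cPPs cPs cPPs_nonneg cPs_nonneg)
open Summit.QuantumFields.BalabanUV.Beta.D1BFx.GhostLeg (Ggh)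
open Summit.QuantumFields.BalabanUV.Beta.D1BFx.RProjectorJet (RG)
open Summit.QuantumFields.BalabanUV.Beta.D1BFx.GluonLeg (Ga)
open Summit.QuantumFields.BalabanUV.Beta.D1BFx.GluonLegTails (spr_Ga_of_prop12)
open Summit.QuantumFields.BalabanUV.Beta.D1BFx.FrozenLegTails (nOf MOf hn1)
open Summit.QuantumFields.BalabanUV.Beta.D1BFx.GhostStencil (qJet)
open Summit.QuantumFields.BalabanUV.Beta.D1BFx.NeedlePotentialLetters (ndlRow)
open Summit.QuantumFields.BalabanUV.Beta.D1BFx.RColumnBlockMass (dR dR_pos)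
open Summit.QuantumFields.BalabanUV.Beta.D1BFx.GluonNeedleSplit (dipPiece ndlPiece)
open Summit.QuantumFields.BalabanUV.Beta.D1BFx.FineHessianSectors (biBubbleTable)
open Summit.QuantumFields.BalabanUV.Beta.D1BFx.RankOneBubble (applyK pairing)
open Summit.QuantumFields.BalabanUV.Beta.D1BFx.RankOneBubbleJets (grad)
open Summit.QuantumFields.BalabanUV.Beta.D1BFx.NeedleNdlProjLetters (exists_applyK_grad_row_le)
open Summit.QuantumFields.BalabanUV.Beta.D1BFx.GluonLocalNdlLetters (exists_applyK_grad_row_diff_le exists_applyK_gradC_diff_le)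
open Summit.QuantumFields.BalabanUV.Beta.D1BFx.NeedleColumnLetters (exists_applyK_gradC_le)
open Summit.QuantumFields.BalabanUV.Beta.D1BFx.NeedleDipDipLetters (exists_legLetters exists_functionLetters)
open Summit.QuantumFields.BalabanUV.Beta.D1BFx.NeedleNdlDipRowLetters (exists_row_leg_flat_bound exists_leg_row_flat_bound exists_row_leg_coul_bound
  exists_leg_row_coul_bound exists_row_leg_dip_bound)
open Summit.QuantumFields.BalabanUV.Beta.D1BFx.NeedleNdlDipColLetters (exists_col_leg_flat_bound exists_leg_col_flat_bound exists_col_leg_coul_bound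
  exists_leg_col_coul_bound exists_col_leg_dip_bound)
open Summit.QuantumFields.BalabanUV.Beta.D1BFx.NeedleNdlDipByParts (abs_pairing_grad_dip_le_of_needle_d1 abs_pairing_grad_dip_le_of_flat_d1)
open Summit.QuantumFields.BalabanUV.Beta.D1BFx.NeedleNdlDipWord (abs_ndlDip_word_le)

variable (a : ℝ) (ha : 0 < a)

/-- [folklore] rate weakening: `e^{−(r∕n)t} ≤ e^{−(δ∕n)t}` for `δ ≤ r`. -/
theorem exp_weaken {δ r : ℝ} (h : δ ≤ r) {n : ℕ} (hn : (0 : ℝ) < n) (t : ℕ) : Real.exp (-(r / n) * t) ≤ Real.exp (-(δ / n) * t) := by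
  refine Real.exp_le_exp.2 ?_
  have ht : (0 : ℝ) ≤ t := Nat.cast_nonneg _
  have : δ / n * t ≤ r / n * t := mul_le_mul_of_nonneg_right (div_le_div_of_nonneg_right h hn.le) ht
  linarith

/-- [folklore] the eight n-power identities of the products of the sixteen constants (`N = n ≠ 0`). -/
theorem npow_identities {N Kr1 Kr2 Kr3 Kl2 Kl3 Kc1 Kc2 Kc3 Kd2 Kd3 kR cF kΦ' Cbp KN cℓ : ℝ} (hN : N ≠ 0) :
    Kr1 * (kR / N ^ 2) * (N ^ 2)⁻¹ * (Kd3 * (cF / N ^ 5) * N ^ 5) = Kr1 * kR * (Kd3 * cF) * (N ^ 4)⁻¹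
    ∧ Kc3 * (cF / N ^ 5) * N ^ 5 * (Cbp * (kΦ' / N ^ 2) * (kR / N ^ 2)) = Kc3 * cF * (Cbp * kΦ' * kR) * (N ^ 4)⁻¹
    ∧ Kr2 * (kR / N ^ 2) * (N ^ 1)⁻¹ * (Kd3 * (cF / N ^ 6) * N ^ 5) = Kr2 * kR * (Kd3 * cF) * (N ^ 4)⁻¹
    ∧ Kc3 * (cF / N ^ 6) * N ^ 5 * (Kl2 * (kR / N ^ 2) * (N ^ 1)⁻¹) = Kc3 * cF * (Kl2 * kR) * (N ^ 4)⁻¹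
    ∧ Kc1 * (kR / N ^ 2) * N * (Kl3 * (cF / N ^ 5) * N) = Kc1 * kR * (Kl3 * cF) * (N ^ 5)⁻¹
    ∧ Kc2 * (kR / N ^ 2) * N ^ 2 * (Kl3 * (cF / N ^ 6) * N) = Kc2 * kR * (Kl3 * cF) * (N ^ 5)⁻¹
    ∧ Kr3 * (cF / N ^ 5) * N * (4 * KN * (kR / N ^ 2) * cℓ * N) = Kr3 * cF * (4 * KN * kR * cℓ) * (N ^ 5)⁻¹
    ∧ Kr3 * (cF / N ^ 6) * N * (Kd2 * (kR / N ^ 2) * N ^ 2) = Kr3 * cF * (Kd2 * kR) * (N ^ 5)⁻¹ := by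
  refine ⟨?_, ?_, ?_, ?_, ?_, ?_, ?_, ?_⟩ <;> field_simp

/-- [folklore] **«GN-33 ∕ NK+KN» — THE WORD ENVELOPE WITH THE n-POWERS CANCELLED**, modulo [B5, Prop. 1.2] ∧ [B5, (1.126)–(1.127)] BY NAME: there are
`δ > 0`, `A₁, A₀ ≥ 0` (depending on `a`, `cQ₀`) such that for every `n ≥ 1`, every `|cQ| ≤ cQ₀` and all bonds `(κ,u)`, `(κ′,v)`,
`|biBubbleTable Ga Ga (ndlPiece n a cQ) (dipPiece n a) κ κ′ u v| ≤ Σ_{s∈B(blk u)} |qJet_u s|·(A₁·n⁻⁴·e^{−(δ∕4n)‖s−v‖}∕nrm(s−v) + A₀·n⁻⁵·e^{−(δ∕4n)‖s−v‖})`. -/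
theorem exists_word_envelope (h12 : B5.Prop12Printed (fam nOf hn1 MOf a ha)) (h126 : B5.Kernel126_127Printed (kfam nOf MOf)) (cQ₀ : ℝ) :
    ∃ δ A₁ A₀ : ℝ, 0 < δ ∧ 0 ≤ A₁ ∧ 0 ≤ A₀ ∧ ∀ (n : ℕ) [NeZero n] (cQ : ℝ), |cQ| ≤ cQ₀ → ∀ (κ κ' : Fin 4) (u v : Pt),
      |biBubbleTable (Ga n a) (Ga n a) (ndlPiece n a cQ) (dipPiece n a) κ κ' u v|
        ≤ ∑ s ∈ B (n - 1) (blk (n - 1) u), |qJet n κ u (blk (n - 1) u) s| *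
            (A₁ * ((n : ℝ) ^ 4)⁻¹ * (Real.exp (-(δ / 4 / n) * Beta.PoissonInterior.supNorm (s - v)) / nrm (s - v))
              + A₀ * ((n : ℝ) ^ 5)⁻¹ * Real.exp (-(δ / 4 / n) * Beta.PoissonInterior.supNorm (s - v))) := by
  -- the letters with their native rates
  obtain ⟨ε₁, kA, kA₁, hε₁, _, hkA, hkA₁, hleg⟩ := exists_legLetters a ha h12 h126
  obtain ⟨ε₂, cF, kR, hε₂, _, hcF, hkR, hfun⟩ := exists_functionLetters a ha
  obtain ⟨kΦ, εΦ, hεΦ, hkΦ, hΦ⟩ := exists_applyK_grad_row_le a ha h12 h126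
  obtain ⟨kΦ', εΦ', hεΦ', hkΦ', hΦ'⟩ := exists_applyK_grad_row_diff_le a ha h12 h126
  obtain ⟨kN, δN, _, hkN, hN⟩ := exists_applyK_gradC_le a ha h12 h126
  obtain ⟨kN', hkN', hN'⟩ := exists_applyK_gradC_diff_le a ha h12 h126
  have hPP := deltaPP_pos 4 ha; have hP := deltaP_pos 4 ha; have hPPs := cPPs_nonneg 4 ha; have hPs := cPs_nonneg 4 ha; have hdR := dR_pos ha
  set δC := min (deltaPP 4 a) (deltaP 4 a) with hδC
  have hδC0 : 0 < δC := lt_min hPP hP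
  -- the common rate
  set δ : ℝ := min ε₁ (min ε₂ (min (dR a / 2) (min δC εΦ'))) with hδ
  have hδ0 : 0 < δ := lt_min hε₁ (lt_min hε₂ (lt_min (half_pos hdR) (lt_min hδC0 hεΦ')))
  have hδ1 : δ ≤ ε₁ := min_le_left _ _
  have hδ2 : δ ≤ ε₂ := (min_le_right _ _).trans (min_le_left _ _)
  have hδR : δ ≤ dR a / 2 := (min_le_right _ _).trans ((min_le_right _ _).trans (min_le_left _ _))
  have hδC' : δ ≤ δC := (min_le_right _ _).trans ((min_le_right _ _).trans ((min_le_right _ _).trans (min_le_left _ _)))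
  have hδΦ' : δ ≤ εΦ' := (min_le_right _ _).trans ((min_le_right _ _).trans ((min_le_right _ _).trans (min_le_right _ _)))
  have hkA' : (0 : ℝ) ≤ 4 * Real.exp 1 * kA := by positivity
  -- the pairing constants (before `n`)
  obtain ⟨Kr1, hKr1, hr1⟩ := exists_row_leg_dip_bound ha hδ0 hδR hkA hkA' hkA₁
  obtain ⟨Kr2, hKr2, hr2⟩ := exists_row_leg_coul_bound ha hδ0 hδR hkA
  obtain ⟨Kr3, hKr3, hr3⟩ := exists_row_leg_flat_bound ha hδ0 hδR hkA
  obtain ⟨Kl2, hKl2, hl2⟩ := exists_leg_row_coul_bound ha hδ0 hδR hkA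
  obtain ⟨Kl3, hKl3, hl3⟩ := exists_leg_row_flat_bound ha hδ0 hδR hkA
  obtain ⟨Kc1, hKc1, hc1⟩ := exists_col_leg_dip_bound ha hδ0 hδC' hkA hkA' hkA₁ cQ₀
  obtain ⟨Kc2, hKc2, hc2⟩ := exists_col_leg_coul_bound ha hδ0 hδC' hkA cQ₀
  obtain ⟨Kc3, hKc3, hc3⟩ := exists_col_leg_flat_bound ha hδ0 hδC' hkA cQ₀
  obtain ⟨Kd2, hKd2, hd2⟩ := exists_leg_col_coul_bound ha hδ0 hδC' hkA cQ₀
  obtain ⟨Kd3, hKd3, hd3⟩ := exists_leg_col_flat_bound ha hδ0 hδC' hkA cQ₀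
  set C₁ : ℝ := |cQ₀| * cPPs 4 a + cPs 4 a with hC₁
  have hC₁0 : 0 ≤ C₁ := by positivity
  set Cbp : ℝ := 4 * (16 * Real.exp δ * (4 * 2 ^ (4 + 3) * 9 ^ (4 - 1))) with hCbp
  set cℓ : ℝ := 2 * (1 + 2 * 4 * 3 ^ (4 - 1) * (1 + 4 / δ)) with hcℓ
  -- the n-free amplitudes
  set A₁ : ℝ := Kr1 * kR * (Kd3 * cF) + Kc3 * cF * (Cbp * kΦ' * kR) + Real.exp (δ / 4) * (Kr2 * kR * (Kd3 * cF) + Kc3 * cF * (Kl2 * kR)) with hA₁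
  set A₀ : ℝ := Kc1 * kR * (Kl3 * cF) + Kc2 * kR * (Kl3 * cF) + Kr3 * cF * (4 * (kN' * C₁) * kR * cℓ) + Kr3 * cF * (Kd2 * kR) with hA₀
  have hCbp0 : 0 ≤ Cbp := by positivity
  have hcℓ0 : 0 ≤ cℓ := by positivity
  refine ⟨δ, A₁, A₀, hδ0, by positivity, by positivity, fun n _ cQ hcQ κ κ' u v => ?_⟩
  clear_value A₁ A₀ Cbp cℓ C₁ δ δC
  have hn : (0 : ℝ) < n := by exact_mod_cast Nat.pos_of_ne_zero (NeZero.ne n)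
  have hn1 : 1 ≤ n := NeZero.one_le
  have hA : Spr (Ga n a) := spr_Ga_of_prop12 (a := a) (ha := ha) h12 h126 n
  have hcQ₀ : |cQ| * cPPs 4 a + cPs 4 a ≤ C₁ := by
    rw [hC₁]; exact add_le_add (mul_le_mul_of_nonneg_right (hcQ.trans (le_abs_self _)) hPPs) le_rfl
  -- the leg letters and the dip function letters at the common rate
  obtain ⟨hA0, hA0', hA1, _⟩ := hleg δ hδ0 hδ1 n
  have hF := fun (w : Pt) (ι : Fin 4) => hfun δ hδ0 hδ2 n w ι
  -- S1 ∕ S4 letters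
  have h11 : ∀ (κ : Fin 4) (u : Pt) (κ' : Fin 4) (v : Pt), |pairing (grad (ndlRow n a κ u))
      (applyK (Ga n a) (grad (fun x => RG (Ggh n a) (Pgt n a) x (v + unitVec κ') () () - RG (Ggh n a) (Pgt n a) x v () ())))|
      ≤ Kr1 * (kR / (n : ℝ) ^ 2) * ((n : ℝ) ^ 2)⁻¹ * ∑ s ∈ B (n - 1) (blk (n - 1) u), |qJet n κ u (blk (n - 1) u) s| *
          (Real.exp (-(δ / 4 / n) * Beta.PoissonInterior.supNorm (s - v)) / nrm (s - v)) :=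
    fun κ u κ' v => hr1 n hA0 hA0' hA1 (kR / (n : ℝ) ^ 2) (by positivity) v _ (hF v κ').2.2.2 κ u
  have h12' : ∀ (κ : Fin 4) (u v : Pt), |pairing (grad (ndlRow n a κ u)) (applyK (Ga n a) (grad (fun x => RG (Ggh n a) (Pgt n a) x v () ())))|
      ≤ Kr2 * (kR / (n : ℝ) ^ 2) * ((n : ℝ) ^ 1)⁻¹ * ∑ s ∈ B (n - 1) (blk (n - 1) u), |qJet n κ u (blk (n - 1) u) s| / nrm (s - v) :=
    fun κ u v => hr2 n hA0 (kR / (n : ℝ) ^ 2) (by positivity) v _ (hF v 0).2.2.1 κ u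
  have h13 : ∀ (κ : Fin 4) (u v : Pt), |pairing (grad (ndlRow n a κ u)) (applyK (Ga n a) (grad (fun q => Pgt n a v q () ())))|
      ≤ Kr3 * (cF / (n : ℝ) ^ 5) * n * ∑ s ∈ B (n - 1) (blk (n - 1) u), |qJet n κ u (blk (n - 1) u) s| *
          Real.exp (-(δ / 4 / n) * Beta.PoissonInterior.supNorm (s - v)) :=
    fun κ u v => hr3 n hA0 (cF / (n : ℝ) ^ 5) (by positivity) v _ (hF v 0).1 κ u
  have h14 : ∀ (κ : Fin 4) (u : Pt) (κ' : Fin 4) (v : Pt), |pairing (grad (ndlRow n a κ u))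
      (applyK (Ga n a) (grad (fun q => Pgt n a v q () () - Pgt n a (v + unitVec κ') q () ())))|
      ≤ Kr3 * (cF / (n : ℝ) ^ 6) * n * ∑ s ∈ B (n - 1) (blk (n - 1) u), |qJet n κ u (blk (n - 1) u) s| *
          Real.exp (-(δ / 4 / n) * Beta.PoissonInterior.supNorm (s - v)) :=
    fun κ u κ' v => hr3 n hA0 (cF / (n : ℝ) ^ 6) (by positivity) v _ (hF v κ').2.1 κ u
  have h41 : ∀ (κ : Fin 4) (u : Pt) (κ' : Fin 4) (v : Pt), |pairing (applyK (Ga n a) (grad (ndlRow n a κ u)))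
      (grad (fun x => RG (Ggh n a) (Pgt n a) x (v + unitVec κ') () () - RG (Ggh n a) (Pgt n a) x v () ()))|
      ≤ Cbp * (kΦ' / (n : ℝ) ^ 2) * (kR / (n : ℝ) ^ 2) * ∑ s ∈ B (n - 1) (blk (n - 1) u), |qJet n κ u (blk (n - 1) u) s| *
          (Real.exp (-(δ / 4 / n) * Beta.PoissonInterior.supNorm (s - v)) / nrm (s - v)) := by
    intro κ u κ' v
    have hM : ∀ (x : Pt) (α : Fin 4), |applyK (Ga n a) (grad (ndlRow n a κ u)) x α|
        ≤ kΦ / (n : ℝ) ^ 2 * ∑ s ∈ B (n - 1) (blk (n - 1) u), |qJet n κ u (blk (n - 1) u) s| := by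
      intro x α
      refine (hΦ n κ u x α).trans (mul_le_mul_of_nonneg_left (Finset.sum_le_sum fun s _ => ?_) (by positivity))
      have hns := nrm_pos (x - s)
      have h1 : Real.exp (-(εΦ / n) * Beta.PoissonInterior.supNorm (x - s)) / nrm (x - s) ^ 1 ≤ 1 := by
        rw [div_le_one (by positivity), pow_one]
        exact (Real.exp_le_one_iff.2 (by
          have : (0 : ℝ) ≤ εΦ / n * Beta.PoissonInterior.supNorm (x - s) := by positivity
          linarith)).trans (PoissonInterior.one_le_nrm _)
      exact (mul_le_mul_of_nonneg_left h1 (abs_nonneg _)).trans (le_of_eq (mul_one _))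
    have hD : ∀ (x : Pt) (α i : Fin 4), |applyK (Ga n a) (grad (ndlRow n a κ u)) (x + unitVec i) α - applyK (Ga n a) (grad (ndlRow n a κ u)) x α|
        ≤ kΦ' / (n : ℝ) ^ 2 * ∑ s ∈ B (n - 1) (blk (n - 1) u), |qJet n κ u (blk (n - 1) u) s| *
            (Real.exp (-(δ / n) * Beta.PoissonInterior.supNorm (x - s)) / nrm (x - s) ^ 2) := by
      intro x α i
      refine (hΦ' n κ u x α i).trans (mul_le_mul_of_nonneg_left (Finset.sum_le_sum fun s _ => ?_) (by positivity))
      have hns := nrm_pos (x - s)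
      exact mul_le_mul_of_nonneg_left (div_le_div_of_nonneg_right (exp_weaken hδΦ' hn _) (by positivity)) (abs_nonneg _)
    rw [hCbp]
    exact abs_pairing_grad_dip_le_of_needle_d1 (B (n - 1) (blk (n - 1) u)) (fun s _ => abs_nonneg _) (fun s => s) hn1 hδ0
      (by positivity) (by positivity) hM hD (hF v κ').2.2.2
  have h42 : ∀ (κ : Fin 4) (u v : Pt), |pairing (applyK (Ga n a) (grad (ndlRow n a κ u))) (grad (fun x => RG (Ggh n a) (Pgt n a) x v () ()))|
      ≤ Kl2 * (kR / (n : ℝ) ^ 2) * ((n : ℝ) ^ 1)⁻¹ * ∑ s ∈ B (n - 1) (blk (n - 1) u), |qJet n κ u (blk (n - 1) u) s| / nrm (s - v) :=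
    fun κ u v => hl2 n hA0 (kR / (n : ℝ) ^ 2) (by positivity) v _ (hF v 0).2.2.1 κ u
  have h43 : ∀ (κ : Fin 4) (u v : Pt), |pairing (applyK (Ga n a) (grad (ndlRow n a κ u))) (grad (fun q => Pgt n a v q () ()))|
      ≤ Kl3 * (cF / (n : ℝ) ^ 5) * n * ∑ s ∈ B (n - 1) (blk (n - 1) u), |qJet n κ u (blk (n - 1) u) s| *
          Real.exp (-(δ / 4 / n) * Beta.PoissonInterior.supNorm (s - v)) :=
    fun κ u v => hl3 n hA0 (cF / (n : ℝ) ^ 5) (by positivity) v _ (hF v 0).1 κ u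
  have h44 : ∀ (κ : Fin 4) (u : Pt) (κ' : Fin 4) (v : Pt), |pairing (applyK (Ga n a) (grad (ndlRow n a κ u)))
      (grad (fun q => Pgt n a v q () () - Pgt n a (v + unitVec κ') q () ()))|
      ≤ Kl3 * (cF / (n : ℝ) ^ 6) * n * ∑ s ∈ B (n - 1) (blk (n - 1) u), |qJet n κ u (blk (n - 1) u) s| *
          Real.exp (-(δ / 4 / n) * Beta.PoissonInterior.supNorm (s - v)) :=
    fun κ u κ' v => hl3 n hA0 (cF / (n : ℝ) ^ 6) (by positivity) v _ (hF v κ').2.1 κ u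
  -- S2 ∕ S3 letters
  have h21 : ∀ (u : Pt) (κ' : Fin 4) (v : Pt), |pairing
      (applyK (Ga n a) (grad (fun q => cQ * (∑ z ∈ B (n - 1) (blk (n - 1) u), Pgt n a z q () ()) - kerP (d := 4) (n - 1) a q (blk (n - 1) u))))
      (grad (fun x => RG (Ggh n a) (Pgt n a) x (v + unitVec κ') () () - RG (Ggh n a) (Pgt n a) x v () ()))|
      ≤ 4 * (kN' * C₁) * (kR / (n : ℝ) ^ 2) * cℓ * n := by
    intro u κ' v
    have hM : ∀ (x : Pt) (α : Fin 4), |applyK (Ga n a)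
        (grad (fun q => cQ * (∑ z ∈ B (n - 1) (blk (n - 1) u), Pgt n a z q () ()) - kerP (d := 4) (n - 1) a q (blk (n - 1) u))) x α|
        ≤ kN * (|cQ| * cPPs 4 a + cPs 4 a) * n := fun x α =>
      (hN n cQ u x α).trans (mul_le_of_le_one_right (by positivity) (Real.exp_le_one_iff.2 (by
        have : (0 : ℝ) ≤ δN * dist (blk (n - 1) x) (blk (n - 1) u) := by positivity
        linarith)))
    have hD : ∀ (x : Pt) (α i : Fin 4), |applyK (Ga n a)
        (grad (fun q => cQ * (∑ z ∈ B (n - 1) (blk (n - 1) u), Pgt n a z q () ()) - kerP (d := 4) (n - 1) a q (blk (n - 1) u))) (x + unitVec i) α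
        - applyK (Ga n a) (grad (fun q => cQ * (∑ z ∈ B (n - 1) (blk (n - 1) u), Pgt n a z q () ()) - kerP (d := 4) (n - 1) a q (blk (n - 1) u))) x α|
        ≤ kN' * C₁ := fun x α i => (hN' n cQ u x α i).trans (mul_le_mul_of_nonneg_left hcQ₀ hkN')
    have h := abs_pairing_grad_dip_le_of_flat_d1 hn1 hδ0 (by positivity : (0 : ℝ) ≤ kR / (n : ℝ) ^ 2) hM hD (hF v κ').2.2.2
    rw [hcℓ]; exact h
  have h22 : ∀ (u v : Pt), |pairing
      (applyK (Ga n a) (grad (fun q => cQ * (∑ z ∈ B (n - 1) (blk (n - 1) u), Pgt n a z q () ()) - kerP (d := 4) (n - 1) a q (blk (n - 1) u))))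
      (grad (fun x => RG (Ggh n a) (Pgt n a) x v () ()))| ≤ Kd2 * (kR / (n : ℝ) ^ 2) * (n : ℝ) ^ 2 *
        Real.exp (-(δ / 4 / n) * Beta.PoissonInterior.supNorm (u - v)) :=
    fun u v => hd2 n cQ hcQ hA0 (kR / (n : ℝ) ^ 2) (by positivity) v _ (hF v 0).2.2.1 u
  have h23 : ∀ (u v : Pt), |pairing
      (applyK (Ga n a) (grad (fun q => cQ * (∑ z ∈ B (n - 1) (blk (n - 1) u), Pgt n a z q () ()) - kerP (d := 4) (n - 1) a q (blk (n - 1) u))))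
      (grad (fun q => Pgt n a v q () ()))| ≤ Kd3 * (cF / (n : ℝ) ^ 5) * (n : ℝ) ^ 5 * Real.exp (-(δ / 4 / n) * Beta.PoissonInterior.supNorm (u - v)) :=
    fun u v => hd3 n cQ hcQ hA0 (cF / (n : ℝ) ^ 5) (by positivity) v _ (hF v 0).1 u
  have h24 : ∀ (u : Pt) (κ' : Fin 4) (v : Pt), |pairing
      (applyK (Ga n a) (grad (fun q => cQ * (∑ z ∈ B (n - 1) (blk (n - 1) u), Pgt n a z q () ()) - kerP (d := 4) (n - 1) a q (blk (n - 1) u))))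
      (grad (fun q => Pgt n a v q () () - Pgt n a (v + unitVec κ') q () ()))|
      ≤ Kd3 * (cF / (n : ℝ) ^ 6) * (n : ℝ) ^ 5 * Real.exp (-(δ / 4 / n) * Beta.PoissonInterior.supNorm (u - v)) :=
    fun u κ' v => hd3 n cQ hcQ hA0 (cF / (n : ℝ) ^ 6) (by positivity) v _ (hF v κ').2.1 u
  have h31 : ∀ (u : Pt) (κ' : Fin 4) (v : Pt), |pairing
      (grad (fun q => cQ * (∑ z ∈ B (n - 1) (blk (n - 1) u), Pgt n a z q () ()) - kerP (d := 4) (n - 1) a q (blk (n - 1) u)))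
      (applyK (Ga n a) (grad (fun x => RG (Ggh n a) (Pgt n a) x (v + unitVec κ') () () - RG (Ggh n a) (Pgt n a) x v () ())))|
      ≤ Kc1 * (kR / (n : ℝ) ^ 2) * n * Real.exp (-(δ / 4 / n) * Beta.PoissonInterior.supNorm (u - v)) :=
    fun u κ' v => hc1 n cQ hcQ hA0 hA0' hA1 (kR / (n : ℝ) ^ 2) (by positivity) v _ (hF v κ').2.2.2 u
  have h32 : ∀ (u v : Pt), |pairing
      (grad (fun q => cQ * (∑ z ∈ B (n - 1) (blk (n - 1) u), Pgt n a z q () ()) - kerP (d := 4) (n - 1) a q (blk (n - 1) u)))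
      (applyK (Ga n a) (grad (fun x => RG (Ggh n a) (Pgt n a) x v () ())))| ≤ Kc2 * (kR / (n : ℝ) ^ 2) * (n : ℝ) ^ 2 *
        Real.exp (-(δ / 4 / n) * Beta.PoissonInterior.supNorm (u - v)) :=
    fun u v => hc2 n cQ hcQ hA0 (kR / (n : ℝ) ^ 2) (by positivity) v _ (hF v 0).2.2.1 u
  have h33 : ∀ (u v : Pt), |pairing
      (grad (fun q => cQ * (∑ z ∈ B (n - 1) (blk (n - 1) u), Pgt n a z q () ()) - kerP (d := 4) (n - 1) a q (blk (n - 1) u)))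
      (applyK (Ga n a) (grad (fun q => Pgt n a v q () ())))| ≤ Kc3 * (cF / (n : ℝ) ^ 5) * (n : ℝ) ^ 5 * Real.exp (-(δ / 4 / n) * Beta.PoissonInterior.supNorm (u - v)) :=
    fun u v => hc3 n cQ hcQ hA0 (cF / (n : ℝ) ^ 5) (by positivity) v _ (hF v 0).1 u
  have h34 : ∀ (u : Pt) (κ' : Fin 4) (v : Pt), |pairing
      (grad (fun q => cQ * (∑ z ∈ B (n - 1) (blk (n - 1) u), Pgt n a z q () ()) - kerP (d := 4) (n - 1) a q (blk (n - 1) u)))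
      (applyK (Ga n a) (grad (fun q => Pgt n a v q () () - Pgt n a (v + unitVec κ') q () ())))|
      ≤ Kc3 * (cF / (n : ℝ) ^ 6) * (n : ℝ) ^ 5 * Real.exp (-(δ / 4 / n) * Beta.PoissonInterior.supNorm (u - v)) :=
    fun u κ' v => hc3 n cQ hcQ hA0 (cF / (n : ℝ) ^ 6) (by positivity) v _ (hF v κ').2.1 u
  -- the word and the n-powers
  have hw := abs_ndlDip_word_le ha hA (cQ := cQ) hδ0.le
    (by positivity) (by positivity) (by positivity) (by positivity) (by positivity) (by positivity) (by positivity) (by positivity)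
    (by positivity) (by positivity) (by positivity) (by positivity) (by positivity) (by positivity) (by positivity)
    h11 h12' h13 h14 h41 h42 h43 h44 h21 h22 h23 h24 h31 h32 h33 h34 κ κ' u v
  refine hw.trans (le_of_eq (Finset.sum_congr rfl fun s _ => ?_))
  have hn0 : (n : ℝ) ≠ 0 := hn.ne'
  obtain ⟨p1, p2, p3, p4, p5, p6, p7, p8⟩ := npow_identities (Kr1 := Kr1) (Kr2 := Kr2) (Kr3 := Kr3) (Kl2 := Kl2) (Kl3 := Kl3) (Kc1 := Kc1)
    (Kc2 := Kc2) (Kc3 := Kc3) (Kd2 := Kd2) (Kd3 := Kd3) (kR := kR) (cF := cF) (kΦ' := kΦ') (Cbp := Cbp) (KN := kN' * C₁) (cℓ := cℓ) hn0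
  rw [p1, p2, p3, p4, p5, p6, p7, p8, hA₁, hA₀]
  ring

end Summit.QuantumFields.BalabanUV.Beta.D1BFx.NeedleNdlDipEnvelope

end
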